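import Summits.Ventures.YMGap.RobustBall.FreeEnergyStrongConvexity
import Summits.Ventures.YMGap.Thresholds.PressureDerivativeSUN
import Summits.Ventures.YMGap.Thresholds.PressureSecondDerivative
import Summits.Ventures.YMGap.Thresholds.PlaquetteMonotone
import HarnessLib

/-!
# The Bregman divergence of the free energy — the relative-entropy / large-deviation rate of the energy density — is
# STRICTLY POSITIVE and UNIFORMLY CONVEX off the diagonal, every `SU(N)`, every dimension `d ≥ 2` (row «C-ENT», the
# every-`N`, every-`d` twin of `BoundaryStateEntropyBoxes.su2_bregman_freeEnergy_pos`)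

Cell `pub-ymgap`, seat ds-3 (gen 19). HONEST FRAMING: strong-coupling LATTICE statements for `SU(N)` Wilson lattice gauge theory on
`ℤ^d`, hypothesis-free; the window `0 < b < N/(12(d−1))` is where the tree's selection-free thermodynamic identity
`f'(b) = −Σ_{i<j}(N − ⟨Re tr U_{p_ij}⟩_ν)` holds for EVERY DLR state `ν ∈ 𝒢(b)`
(`PressureRegularity.hasDerivAt_freeEnergyDensity_dim_thooft_of_mem`); nothing about the continuum limit or Clay.

THE OBJECT. For `f = freeEnergyDensity d ρ_N` (convex, `C¹` on the window) and a DLR state `ν` at coupling `b`, the BREGMAN DIVERGENCE of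
`f` from `b` to an arbitrary real coupling `b'`,
`I_b(b') := f(b') − f(b) − f'(b)(b' − b) = f(b') − f(b) + (b' − b)·Σ_{i<j}(N − ⟨Re tr U_{p_ij}⟩_ν)`,
is the relative-entropy density between the states at `b'` and `b` (`BoundaryStatesRelativeEntropyDim`) and the large-deviation rate of the
cube energy density at the exposed level of `b'` (`EnergyLargeDeviations*`). Here, from the tree's STRONG convexity of `f`
(`EnergyVariance.strongConvexOn_freeEnergyDensity`, modulus `m(B) = ½·e^{−8(d−1)N·B}·charVariance ρ_N` on `[−B, B]`) and strict convexity
(`EnergyVariance.strictConvexOn_freeEnergyDensity`):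

* `bregman_pos_of_strictConvexOn`, `bregman_ge_of_strongConvexOn` — the two generic real-variable facts (strictly convex + differentiable at
  `x` ⇒ `f(y) − f(x) − f'(x)(y − x) > 0` for `y ≠ x`; `m`-strongly convex ⇒ `≥ (m/2)(y − x)²`);
* ★★ `suN_bregman_freeEnergy_pos_dim` — `I_b(b') > 0` for every real `b' ≠ b`, `0 < b < N/(12(d−1))`, EVERY DLR state `ν ∈ 𝒢(b)`;
* ★★ `suN_bregman_freeEnergy_ge_dim` — the quantitative floor `I_b(b') ≥ ¼·e^{−8(d−1)N·max(|b|,|b'|)}·charVariance ρ_N·(b' − b)²`;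
* ★★ `su2_bregman_freeEnergy_ge` — `SU(2)`, `d = 4`, on the WHOLE window `0 < b < 9/50` and in the per-plaquette normalisation of
  `BoundaryStateEntropyBoxes` / `EnergyLargeDeviations*`: `e^{−48·max(|b|,|b'|)}/24·(b' − b)² ≤ (b' − b)(2 − u(b)) + (f(b') − f(b))/6` (`u(b) = μ(Re tr U_p)`);
* ★ `suN_jeffreys_freeEnergy_pos_dim` / `_ge_dim` — the symmetrised (Jeffreys) form `I_b(b') + I_{b'}(b) = (b' − b)·(e(ν) − e(ν'))`,
  `e(ν) = Σ_{i<j}(N − ⟨Re tr U_{p_ij}⟩_ν)`: strictly positive, `≥ ½·e^{−8(d−1)N·max(b,b')}·charVariance ρ_N·(b' − b)²` — the plane-summed energy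
  density is strictly decreasing in the coupling across ANY two DLR states of the window (selection-free).

WHAT THIS IS NOT: nothing about `d = 4` specifically, the continuum, or Clay; the identification of `I_b(b')` with the relative-entropy density /
LD rate is in the (separate) boundary-entropy files. Everything here is proved. [folklore]
-/

noncomputable section

open MeasureTheory Set

namespace Summit.Ventures.YMGap.RobustBall

namespace FreeEnergyBregman

/-! ### Generic: Bregman divergence of a strictly / strongly convex real function -/

/-- **Bregman divergence of a strictly convex function is strictly positive off the diagonal**: `f` strictly convex on `S`, differentiable at
`x ∈ S` with derivative `m`, `y ∈ S`, `y ≠ x` ⇒ `0 < f(y) − f(x) − m(y − x)`. [folklore] -/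
theorem bregman_pos_of_strictConvexOn {S : Set ℝ} {f : ℝ → ℝ} {m x y : ℝ} (hsc : StrictConvexOn ℝ S f) (hx : x ∈ S) (hy : y ∈ S)
    (hD : HasDerivAt f m x) (hne : x ≠ y) : 0 < f y - f x - m * (y - x) := by
  rcases lt_or_gt_of_ne hne with hlt | hgt
  · have h := hsc.lt_slope_of_hasDerivAt hx hy hlt hD
    rw [slope_def_field, lt_div_iff₀ (sub_pos.2 hlt)] at h
    linarith
  · have h := hsc.slope_lt_of_hasDerivAt hy hx hgt hD
    rw [slope_def_field, div_lt_iff₀ (sub_pos.2 hgt)] at h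
    have e : f y - f x - m * (y - x) = m * (x - y) - (f x - f y) := by ring
    rw [e]; linarith

/-- **Bregman divergence of an `μ`-strongly convex function is at least `(μ/2)(y − x)²`**: `f` `μ`-strongly convex on `S`, differentiable at
`x ∈ S` with derivative `m`, `y ∈ S` ⇒ `(μ/2)(y − x)² ≤ f(y) − f(x) − m(y − x)`. [folklore] -/
theorem bregman_ge_of_strongConvexOn {S : Set ℝ} {f : ℝ → ℝ} {μ m x y : ℝ} (hsc : StrongConvexOn S μ f) (hx : x ∈ S) (hy : y ∈ S)
    (hD : HasDerivAt f m x) : μ / 2 * (y - x) ^ 2 ≤ f y - f x - m * (y - x) := by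
  have hconv := EnergyVariance.strongConvexOn_real_iff.1 hsc
  have hg : HasDerivAt (fun t => f t - μ / 2 * t ^ 2) (m - μ * x) x := hD.sub (EnergyVariance.hasDerivAt_half_mul_sq μ x)
  rcases lt_trichotomy x y with hlt | heq | hgt
  · have h := hconv.le_slope_of_hasDerivAt hx hy hlt hg
    simp only [slope_def_field] at h
    rw [le_div_iff₀ (sub_pos.2 hlt)] at h
    have e : f y - f x - m * (y - x) - μ / 2 * (y - x) ^ 2 =
        (f y - μ / 2 * y ^ 2 - (f x - μ / 2 * x ^ 2)) - (m - μ * x) * (y - x) := by ring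
    rw [← sub_nonneg, e]; exact sub_nonneg.2 h
  · subst heq; simp
  · have h := hconv.slope_le_of_hasDerivAt hy hx hgt hg
    simp only [slope_def_field] at h
    rw [div_le_iff₀ (sub_pos.2 hgt)] at h
    have e : f y - f x - m * (y - x) - μ / 2 * (y - x) ^ 2 =
        (m - μ * x) * (x - y) - (f x - μ / 2 * x ^ 2 - (f y - μ / 2 * y ^ 2)) := by ring
    rw [← sub_nonneg, e]; exact sub_nonneg.2 h

/-! ### Every `SU(N)`, every `d ≥ 2`: the Bregman divergence of the free energy on the 't Hooft window -/

variable {d N : ℕ}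

open Literature.MathematicalPhysics.QuantumLattice (LGConfig fundamentalRep ymGibbsMeasures freeEnergyDensity plaquetteObs)

local notation3 (prettyPrint := false) "𝔓" d => {q : Fin d × Fin d // q.1 < q.2}

/-- ★★ **THE BREGMAN DIVERGENCE OF THE FREE ENERGY IS STRICTLY POSITIVE OFF THE DIAGONAL — every `SU(N)`, every `d ≥ 2`**
(`0 < b < N/(12(d−1))`, `ν` ANY DLR state at `b`, ANY real `b' ≠ b`):
`0 < f(b') − f(b) + (b' − b)·Σ_{i<j}(N − ⟨Re tr U_{p_ij}⟩_ν)` — strict convexity of `f` and the selection-free thermodynamic identity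
`f'(b) = −Σ_{i<j}(N − ⟨Re tr U_{p_ij}⟩_ν)`. [folklore] -/
theorem suN_bregman_freeEnergy_pos_dim (hd : 2 ≤ d) (hN : 2 ≤ N) {b b' : ℝ} (hb : b ∈ Ioo (0 : ℝ) ((N : ℝ) / (12 * ((d : ℝ) - 1))))
    {ν : Measure (LGConfig d (Matrix.specialUnitaryGroup (Fin N) ℂ))} (hν : ν ∈ ymGibbsMeasures (d := d) (fundamentalRep (Fin N)) b)
    (hne : b ≠ b') :
    0 < freeEnergyDensity d (fundamentalRep (Fin N)) b' - freeEnergyDensity d (fundamentalRep (Fin N)) b +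
      (b' - b) * ∑ q : 𝔓 d, ((N : ℝ) - ∫ U, plaquetteObs (fundamentalRep (Fin N)) 0 q.1.1 q.1.2 U ∂ν) := by
  set f := freeEnergyDensity d (fundamentalRep (Fin N)) with hf
  set S := ∑ q : 𝔓 d, ((N : ℝ) - ∫ U, plaquetteObs (fundamentalRep (Fin N)) 0 q.1.1 q.1.2 U ∂ν) with hS
  have hsc := EnergyVariance.strictConvexOn_freeEnergyDensity (d := d) (fundamentalRep (Fin N))
    (Literature.MathematicalPhysics.QuantumFieldTheory.TorusAreaLaw.isSpecialUnitaryModel_fundamentalRep N) hN hd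
  have hD := (PressureRegularity.hasDerivAt_freeEnergyDensity_dim_thooft_of_mem hd hN hb hν).1
  have h := bregman_pos_of_strictConvexOn hsc (mem_univ b) (mem_univ b') hD hne
  have e : f b' - f b + (b' - b) * S = f b' - f b - (-S) * (b' - b) := by ring
  rw [e]; exact h

/-- ★★ **QUANTITATIVE FLOOR — THE RATE IS UNIFORMLY CONVEX — every `SU(N)`, every `d ≥ 2`** (`0 < b < N/(12(d−1))`, `ν` ANY DLR state at `b`,
ANY real `b'`): `¼·e^{−8(d−1)N·max(|b|,|b'|)}·charVariance ρ_N·(b' − b)² ≤ f(b') − f(b) + (b' − b)·Σ_{i<j}(N − ⟨Re tr U_{p_ij}⟩_ν)` — the strong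
convexity of `f` on `[−B, B]` (`EnergyVariance.strongConvexOn_freeEnergyDensity`) with `B = max(|b|,|b'|)`. [folklore] -/
theorem suN_bregman_freeEnergy_ge_dim (hd : 2 ≤ d) (hN : 2 ≤ N) {b : ℝ} (hb : b ∈ Ioo (0 : ℝ) ((N : ℝ) / (12 * ((d : ℝ) - 1))))
    {ν : Measure (LGConfig d (Matrix.specialUnitaryGroup (Fin N) ℂ))} (hν : ν ∈ ymGibbsMeasures (d := d) (fundamentalRep (Fin N)) b)
    (b' : ℝ) :
    (1 / 4 : ℝ) * Real.exp (-(8 * (d - 1 : ℕ) * N * max |b| |b'|)) *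
        Literature.MathematicalPhysics.QuantumFieldTheory.PlaquetteLowerBound.charVariance (fundamentalRep (Fin N)) * (b' - b) ^ 2 ≤
      freeEnergyDensity d (fundamentalRep (Fin N)) b' - freeEnergyDensity d (fundamentalRep (Fin N)) b +
        (b' - b) * ∑ q : 𝔓 d, ((N : ℝ) - ∫ U, plaquetteObs (fundamentalRep (Fin N)) 0 q.1.1 q.1.2 U ∂ν) := by
  set f := freeEnergyDensity d (fundamentalRep (Fin N)) with hf
  set S := ∑ q : 𝔓 d, ((N : ℝ) - ∫ U, plaquetteObs (fundamentalRep (Fin N)) 0 q.1.1 q.1.2 U ∂ν) with hS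
  set B : ℝ := max |b| |b'| with hB
  have hsc := EnergyVariance.strongConvexOn_freeEnergyDensity (d := d) (fundamentalRep (Fin N))
    (Literature.MathematicalPhysics.QuantumFieldTheory.TorusAreaLaw.isSpecialUnitaryModel_fundamentalRep N) hN hd B
  have hbB : b ∈ Icc (-B) B :=
    ⟨by rw [hB]; linarith [neg_abs_le b, le_max_left |b| |b'|], (le_abs_self b).trans (le_max_left _ _)⟩
  have hb'B : b' ∈ Icc (-B) B :=
    ⟨by rw [hB]; linarith [neg_abs_le b', le_max_right |b| |b'|], (le_abs_self b').trans (le_max_right _ _)⟩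
  have hD := (PressureRegularity.hasDerivAt_freeEnergyDensity_dim_thooft_of_mem hd hN hb hν).1
  have h := bregman_ge_of_strongConvexOn hsc hbB hb'B hD
  have e1 : (1 / 4 : ℝ) * Real.exp (-(8 * (d - 1 : ℕ) * N * B)) *
        Literature.MathematicalPhysics.QuantumFieldTheory.PlaquetteLowerBound.charVariance (fundamentalRep (Fin N)) * (b' - b) ^ 2 =
      (1 / 2 : ℝ) * Real.exp (-(8 * (d - 1 : ℕ) * N * B)) *
        Literature.MathematicalPhysics.QuantumFieldTheory.PlaquetteLowerBound.charVariance (fundamentalRep (Fin N)) / 2 * (b' - b) ^ 2 := by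
    ring
  have e2 : f b' - f b + (b' - b) * S = f b' - f b - (-S) * (b' - b) := by ring
  rw [e1, e2]; exact h

/-- ★ **THE JEFFREYS (SYMMETRISED) DIVERGENCE DENSITY IS STRICTLY POSITIVE — every `SU(N)`, every `d ≥ 2`** (`b ≠ b'` both in
`(0, N/(12(d−1)))`, `ν ∈ 𝒢(b)`, `ν' ∈ 𝒢(b')` ANY DLR states): `I_b(b') + I_{b'}(b) = (b' − b)·(e(ν) − e(ν')) > 0`,
`e(ν) = Σ_{i<j}(N − ⟨Re tr U_{p_ij}⟩_ν)` — the plane-summed energy density is STRICTLY DECREASING in the coupling across any two DLR states of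
the window (selection-free). [folklore] -/
theorem suN_jeffreys_freeEnergy_pos_dim (hd : 2 ≤ d) (hN : 2 ≤ N) {b b' : ℝ} (hb : b ∈ Ioo (0 : ℝ) ((N : ℝ) / (12 * ((d : ℝ) - 1))))
    (hb' : b' ∈ Ioo (0 : ℝ) ((N : ℝ) / (12 * ((d : ℝ) - 1))))
    {ν ν' : Measure (LGConfig d (Matrix.specialUnitaryGroup (Fin N) ℂ))} (hν : ν ∈ ymGibbsMeasures (d := d) (fundamentalRep (Fin N)) b)
    (hν' : ν' ∈ ymGibbsMeasures (d := d) (fundamentalRep (Fin N)) b') (hne : b ≠ b') :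
    0 < (b' - b) * (∑ q : 𝔓 d, ((N : ℝ) - ∫ U, plaquetteObs (fundamentalRep (Fin N)) 0 q.1.1 q.1.2 U ∂ν) -
      ∑ q : 𝔓 d, ((N : ℝ) - ∫ U, plaquetteObs (fundamentalRep (Fin N)) 0 q.1.1 q.1.2 U ∂ν')) := by
  set f := freeEnergyDensity d (fundamentalRep (Fin N)) with hf
  set S := ∑ q : 𝔓 d, ((N : ℝ) - ∫ U, plaquetteObs (fundamentalRep (Fin N)) 0 q.1.1 q.1.2 U ∂ν) with hS
  set S' := ∑ q : 𝔓 d, ((N : ℝ) - ∫ U, plaquetteObs (fundamentalRep (Fin N)) 0 q.1.1 q.1.2 U ∂ν') with hS'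
  have h1 := suN_bregman_freeEnergy_pos_dim hd hN hb hν hne
  have h2 := suN_bregman_freeEnergy_pos_dim hd hN hb' hν' hne.symm
  have e : (b' - b) * (S - S') = (f b' - f b + (b' - b) * S) + (f b - f b' + (b - b') * S') := by ring
  rw [e]; exact add_pos h1 h2

/-- ★ **QUANTITATIVE JEFFREYS FLOOR — every `SU(N)`, every `d ≥ 2`** (`b, b'` in `(0, N/(12(d−1)))`, `ν ∈ 𝒢(b)`, `ν' ∈ 𝒢(b')`):
`½·e^{−8(d−1)N·max(|b|,|b'|)}·charVariance ρ_N·(b' − b)² ≤ (b' − b)·(e(ν) − e(ν'))`. [folklore] -/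
theorem suN_jeffreys_freeEnergy_ge_dim (hd : 2 ≤ d) (hN : 2 ≤ N) {b b' : ℝ} (hb : b ∈ Ioo (0 : ℝ) ((N : ℝ) / (12 * ((d : ℝ) - 1))))
    (hb' : b' ∈ Ioo (0 : ℝ) ((N : ℝ) / (12 * ((d : ℝ) - 1))))
    {ν ν' : Measure (LGConfig d (Matrix.specialUnitaryGroup (Fin N) ℂ))} (hν : ν ∈ ymGibbsMeasures (d := d) (fundamentalRep (Fin N)) b)
    (hν' : ν' ∈ ymGibbsMeasures (d := d) (fundamentalRep (Fin N)) b') :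
    (1 / 2 : ℝ) * Real.exp (-(8 * (d - 1 : ℕ) * N * max |b| |b'|)) *
        Literature.MathematicalPhysics.QuantumFieldTheory.PlaquetteLowerBound.charVariance (fundamentalRep (Fin N)) * (b' - b) ^ 2 ≤
      (b' - b) * (∑ q : 𝔓 d, ((N : ℝ) - ∫ U, plaquetteObs (fundamentalRep (Fin N)) 0 q.1.1 q.1.2 U ∂ν) -
        ∑ q : 𝔓 d, ((N : ℝ) - ∫ U, plaquetteObs (fundamentalRep (Fin N)) 0 q.1.1 q.1.2 U ∂ν')) := by
  set f := freeEnergyDensity d (fundamentalRep (Fin N)) with hf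
  set S := ∑ q : 𝔓 d, ((N : ℝ) - ∫ U, plaquetteObs (fundamentalRep (Fin N)) 0 q.1.1 q.1.2 U ∂ν) with hS
  set S' := ∑ q : 𝔓 d, ((N : ℝ) - ∫ U, plaquetteObs (fundamentalRep (Fin N)) 0 q.1.1 q.1.2 U ∂ν') with hS'
  have h1 := suN_bregman_freeEnergy_ge_dim hd hN hb hν b'
  have h2 := suN_bregman_freeEnergy_ge_dim hd hN hb' hν' b
  rw [max_comm] at h2
  have e : (b' - b) * (S - S') = (f b' - f b + (b' - b) * S) + (f b - f b' + (b - b') * S') := by ring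
  have e2 : (b - b') ^ 2 = (b' - b) ^ 2 := by ring
  rw [e2] at h2
  rw [e]; linarith

/-! ### `SU(2)`, `d = 4`: the whole window `0 < b < 9/50`, per-plaquette normalisation -/

open Literature.MathematicalPhysics.QuantumLattice (ZdPlaquette)

/-- ★★ **`SU(2)`, `d = 4`: QUADRATIC FLOOR FOR THE BREGMAN DIVERGENCE PER PLAQUETTE on the whole window `0 < b < 9/50`** (`μ` THE DLR state at
`b`, `u = μ(Re tr U_p)`, ANY real `b'`): `e^{−48·max(|b|,|b'|)}/24·(b' − b)² ≤ (b' − b)(2 − u) + (f(b') − f(b))/6` — the relative-entropy density /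
large-deviation rate of `BoundaryStateEntropyBoxes` / `EnergyLargeDeviations*` is uniformly convex in `b'`
(`EnergyVariance.su2_strongConvexOn_freeEnergyDensity_dim4`, `PressureRegularity.su2_hasDerivAt_freeEnergyDensity_of_mem`, and the plane symmetry
`PressureRegularity.su2_integral_plaquetteObs_eq`). [folklore] -/
theorem su2_bregman_freeEnergy_ge {b : ℝ} (hb : b ∈ Ioo (0 : ℝ) (9 / 50)) {μ : Measure (LGConfig 4 (Matrix.specialUnitaryGroup (Fin 2) ℂ))}
    (hμ : μ ∈ ymGibbsMeasures (d := 4) (fundamentalRep (Fin 2)) b) (b' : ℝ) :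
    Real.exp (-(48 * max |b| |b'|)) / 24 * (b' - b) ^ 2 ≤
      (b' - b) * ((2 : ℝ) - ∫ U, plaquetteObs (fundamentalRep (Fin 2)) 0 0 1 U ∂μ) +
        (freeEnergyDensity 4 (fundamentalRep (Fin 2)) b' - freeEnergyDensity 4 (fundamentalRep (Fin 2)) b) / 6 := by
  set f := freeEnergyDensity 4 (fundamentalRep (Fin 2)) with hf
  set u := ∫ U, plaquetteObs (fundamentalRep (Fin 2)) 0 0 1 U ∂μ with hu
  set B : ℝ := max |b| |b'| with hB
  have hsc := EnergyVariance.su2_strongConvexOn_freeEnergyDensity_dim4 B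
  have hbB : b ∈ Icc (-B) B :=
    ⟨by rw [hB]; linarith [neg_abs_le b, le_max_left |b| |b'|], (le_abs_self b).trans (le_max_left _ _)⟩
  have hb'B : b' ∈ Icc (-B) B :=
    ⟨by rw [hB]; linarith [neg_abs_le b', le_max_right |b| |b'|], (le_abs_self b').trans (le_max_right _ _)⟩
  have hD := PressureRegularity.su2_hasDerivAt_freeEnergyDensity_of_mem hb hμ
  have hplanes : ∑ q : 𝔓 4, ((2 : ℝ) - ∫ U, plaquetteObs (fundamentalRep (Fin 2)) 0 q.1.1 q.1.2 U ∂μ) = 6 * (2 - u) := by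
    rw [Finset.sum_congr rfl fun q _ => by
      rw [PressureRegularity.su2_integral_plaquetteObs_eq (Ioo_subset_Icc_self hb) hμ ((0, q) : ZdPlaquette 4)]]
    rw [Finset.sum_const, Finset.card_univ, nsmul_eq_mul]
    have hcard : (Fintype.card (𝔓 4) : ℝ) = 6 := by rw [Fintype.card_subtype]; norm_cast
    rw [hcard]
  rw [hplanes] at hD
  have h := bregman_ge_of_strongConvexOn hsc hbB hb'B hD
  have e : (b' - b) * (2 - u) + (f b' - f b) / 6 = (f b' - f b - -(6 * (2 - u)) * (b' - b)) / 6 := by ring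
  rw [e, le_div_iff₀ (by norm_num : (0 : ℝ) < 6)]
  have e2 : Real.exp (-(48 * B)) / 24 * (b' - b) ^ 2 * 6 = Real.exp (-(48 * B)) / 2 / 2 * (b' - b) ^ 2 := by ring
  rw [e2]; exact h

end FreeEnergyBregman

end Summit.Ventures.YMGap.RobustBall

end
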